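import Summits.KontsevichZagierPeriods.KontsevichZagierPeriods.Theses.FurushoPentagon
import Summits.KontsevichZagierPeriods.KontsevichZagierPeriods.Theorems.FurushoPentagonReducedPeriodRingDefs
import Literature.NumberTheory.Transcendental.KZCubicalCalculus
import Literature.NumberTheory.Transcendental.KZLogCalculusProofs

/-!
# `SectorToKernel`, line `effective-cube-surjection`, dimension-one rung: analytic off a finite set (R2)

Granted the real Puiseux normal form to the right of a point (the registered stub R1, which enters
here VERBATIM as the hypothesis of the theorem), a continuous real function `f` satisfying a
non-trivial polynomial relation `P(s, f s) = 0` on a bounded open interval `(lo, hi)` is real-analytic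
at all but finitely many points of `(lo, hi)` (`stub_analyticOffFinite`).

Proof.  To the right of a point `p`, the normal form `f (p + tᵉ) = tᵐ · G t` (or `f (p + tᵉ) = 0`) for
`t ∈ (0, r)` gives `f s = φ(s)ᵐ · G (φ s)` (or `f s = 0`) on the open interval `(p, p + rᵉ)`, where
`φ s = (s - p)^{1/e} = exp (e⁻¹ · log (s - p))` is real-analytic for `s > p`; hence `f` is analytic on
`(p, p + rᵉ)` (`aoff_analyticAt_of_normalForm`).  Reflecting (`s ↦ f (-s)`, polynomial relation
`P(-X₀, X₁)`, `aoff_reflect_relation`) gives analyticity on a left punctured neighbourhood of every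
point as well.  Compactness of `[lo, hi]` then yields finitely many centres, which form the exceptional
finite set.

References: L. van den Dries, *Tame topology and o-minimal structures* (1998), Ch. 3;
E. Brieskorn, H. Knörrer, *Plane algebraic curves* (1986), §8.3 (Newton–Puiseux); folklore.
-/

noncomputable section

namespace Summit.KontsevichZagierPeriods.FurushoPentagon.SectorToKernel

open Set MeasureTheory
open Literature.NumberTheory.Transcendental
open Literature.NumberTheory.Transcendental.KZ hiding cubicalSpan
open Summit.KontsevichZagierPeriods.KontsevichZagierPeriods.Theses.FurushoPentagon
open Summit.KontsevichZagierPeriods.FurushoPentagon.ReducedPeriodRing (unitCube cubicalGens cubicalSpan)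

open scoped Topology

/-- The real power `s ↦ (s - p) ^ c` (as `Real.rpow`) is real-analytic at every `s > p`, since
`(s - p) ^ c = exp (log (s - p) · c)` there. [folklore] -/
theorem aoff_analyticAt_rpow_sub {p s : ℝ} (c : ℝ) (hs : p < s) :
    AnalyticAt ℝ (fun s' : ℝ => (s' - p) ^ c) s := by
  have h : (fun s' : ℝ => Real.exp (Real.log (s' - p) * c)) =ᶠ[𝓝 s]
      fun s' : ℝ => (s' - p) ^ c := by
    filter_upwards [isOpen_Ioi.mem_nhds hs] with s' hs'
    exact (Real.rpow_def_of_pos (sub_pos.2 hs') _).symm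
  refine AnalyticAt.congr ?_ h
  have h1 : AnalyticAt ℝ (fun s' : ℝ => s' - p) s := analyticAt_id.fun_sub analyticAt_const
  exact ((h1.log (sub_pos.2 hs)).mul analyticAt_const).rexp

/-- The real `e`-th root `(s - p)^{1/e}` of `s - p`, for `s ∈ (p, p + rᵉ)`, lies in `(0, r)` and its
`e`-th power is `s - p`. [folklore] -/
theorem aoff_root_mem {p r s : ℝ} {e : ℕ} (he : e ≠ 0) (hr : 0 < r) (hs : s ∈ Set.Ioo p (p + r ^ e)) :
    (s - p) ^ ((e : ℝ)⁻¹) ∈ Set.Ioo (0 : ℝ) r ∧ p + ((s - p) ^ ((e : ℝ)⁻¹)) ^ e = s := by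
  refine ⟨⟨Real.rpow_pos_of_pos (sub_pos.2 hs.1) _, ?_⟩, ?_⟩
  · have h1 : (s - p) ^ ((e : ℝ)⁻¹) < (r ^ e) ^ ((e : ℝ)⁻¹) :=
      Real.rpow_lt_rpow (sub_nonneg.2 hs.1.le) (by linarith [hs.2])
        (inv_pos.2 (Nat.cast_pos.2 (Nat.pos_of_ne_zero he)))
    rwa [Real.pow_rpow_inv_natCast hr.le he] at h1
  · rw [Real.rpow_inv_natCast_pow (sub_nonneg.2 hs.1.le) he]
    ring

/-- To the right of `p`, a Puiseux normal form `f (p + tᵉ) = tᵐ · G t` (or `f (p + tᵉ) = 0`) for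
`t ∈ (0, r)`, with `G` real-analytic on `(-r, r)`, makes `f` real-analytic at every point of
`(p, p + rᵉ)`: substitute `t = (s - p)^{1/e}`, which is analytic in `s > p`. [folklore] -/
theorem aoff_analyticAt_of_normalForm {f : ℝ → ℝ} {p r : ℝ} {e : ℕ} (he : 0 < e) (hr : 0 < r)
    (h : (∀ t ∈ Set.Ioo (0:ℝ) r, f (p + t ^ e) = 0) ∨ ∃ (m : ℤ) (G : ℝ → ℝ),
      AnalyticOnNhd ℝ G (Set.Ioo (-r) r) ∧ G 0 ≠ 0 ∧ ∀ t ∈ Set.Ioo (0:ℝ) r,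
        f (p + t ^ e) = t ^ m * G t) :
    ∀ s ∈ Set.Ioo p (p + r ^ e), AnalyticAt ℝ f s := by
  intro s hs
  have he0 : e ≠ 0 := Nat.pos_iff_ne_zero.1 he
  have hU : Set.Ioo p (p + r ^ e) ∈ 𝓝 s := isOpen_Ioo.mem_nhds hs
  rcases h with h0 | ⟨m, G, hG, -, hfG⟩
  · have hev : (fun _ : ℝ => (0 : ℝ)) =ᶠ[𝓝 s] f := by
      filter_upwards [hU] with s' hs'
      obtain ⟨hmem, hpow⟩ := aoff_root_mem he0 hr hs'
      have := h0 _ hmem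
      rwa [hpow, eq_comm] at this
    exact analyticAt_const.congr hev
  · have hφa : AnalyticAt ℝ (fun s' : ℝ => (s' - p) ^ ((e : ℝ)⁻¹)) s :=
      aoff_analyticAt_rpow_sub _ hs.1
    obtain ⟨hmem, -⟩ := aoff_root_mem he0 hr hs
    have hGφ : AnalyticAt ℝ (fun s' : ℝ => G ((s' - p) ^ ((e : ℝ)⁻¹))) s :=
      (hG _ ⟨by linarith [hmem.1], hmem.2⟩).fun_comp_of_eq hφa rfl
    have hzpow : AnalyticAt ℝ (fun s' : ℝ => ((s' - p) ^ ((e : ℝ)⁻¹)) ^ m) s :=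
      hφa.fun_zpow hmem.1.ne'
    have hev : (fun s' : ℝ => ((s' - p) ^ ((e : ℝ)⁻¹)) ^ m * G ((s' - p) ^ ((e : ℝ)⁻¹))) =ᶠ[𝓝 s]
        f := by
      filter_upwards [hU] with s' hs'
      obtain ⟨hmem', hpow⟩ := aoff_root_mem he0 hr hs'
      have := hfG _ hmem'
      rwa [hpow, eq_comm] at this
    exact (hzpow.mul hGφ).congr hev

/-- Reflecting the first variable of a non-zero bivariate polynomial: there is `Q ≠ 0` with
`Q(x, y) = P(-x, y)` (namely `Q = P(-X₀, X₁)`, an involutive substitution). [folklore] -/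
theorem aoff_reflect_relation {P : MvPolynomial (Fin 2) ℝ} (hP : P ≠ 0) :
    ∃ Q : MvPolynomial (Fin 2) ℝ, Q ≠ 0 ∧
      ∀ x y : ℝ, MvPolynomial.eval ![x, y] Q = MvPolynomial.eval ![-x, y] P := by
  obtain ⟨h, hh⟩ : ∃ h : Fin 2 → MvPolynomial (Fin 2) ℝ,
      h = ![-MvPolynomial.X 0, MvPolynomial.X 1] := ⟨_, rfl⟩
  refine ⟨MvPolynomial.bind₁ h P, fun hQ => hP ?_, fun x y => ?_⟩
  · have hinv : MvPolynomial.bind₁ h (MvPolynomial.bind₁ h P) = P := by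
      rw [MvPolynomial.bind₁_bind₁]
      have hX : (fun i => MvPolynomial.bind₁ h (h i)) = MvPolynomial.X := by
        funext i
        fin_cases i <;> simp [hh]
      rw [hX, MvPolynomial.bind₁_X_left, AlgHom.id_apply]
    rw [← hinv, hQ, map_zero]
  · have key : MvPolynomial.eval ![x, y] (MvPolynomial.bind₁ h P) =
        MvPolynomial.eval (fun i => MvPolynomial.eval ![x, y] (h i)) P :=
      MvPolynomial.eval₂Hom_bind₁ _ _ _ _
    have hfun : (fun i => MvPolynomial.eval ![x, y] (h i)) = ![-x, y] := by
      funext i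
      fin_cases i <;> simp [hh]
    rw [key, hfun]

/-- **R2 (analytic off a finite set).** Granted R1 (the real Puiseux normal form to the right of a
point, the hypothesis): a continuous real function satisfying a non-trivial polynomial relation on a
bounded open interval is real-analytic at all but finitely many of its points (R1 on both sides of
every point of the closed interval, then compactness). [van den Dries 1998, Ch. 3; folklore] -/
theorem stub_analyticOffFinite :
    (∀ (f : ℝ → ℝ) (a δ : ℝ), 0 < δ → ContinuousOn f (Set.Ioo a (a + δ)) → (∃ P : MvPolynomial (Fin 2) ℝ, P ≠ 0 ∧ ∀ s ∈ Set.Ioo a (a + δ), MvPolynomial.eval ![s, f s] P = 0) → ∃ (e : ℕ) (r : ℝ), 0 < e ∧ 0 < r ∧ r ^ e ≤ δ ∧ ((∀ t ∈ Set.Ioo (0:ℝ) r, f (a + t ^ e) = 0) ∨ ∃ (m : ℤ) (G : ℝ → ℝ), AnalyticOnNhd ℝ G (Set.Ioo (-r) r) ∧ G 0 ≠ 0 ∧ ∀ t ∈ Set.Ioo (0:ℝ) r, f (a + t ^ e) = t ^ m * G t)) → ∀ (f : ℝ → ℝ) (lo hi : ℝ), lo < hi → ContinuousOn f (Set.Ioo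 lo hi) → (∃ P : MvPolynomial (Fin 2) ℝ, P ≠ 0 ∧ ∀ s ∈ Set.Ioo lo hi, MvPolynomial.eval ![s, f s] P = 0) → ∃ Z : Finset ℝ, ∀ s ∈ Set.Ioo lo hi, s ∉ Z → AnalyticAt ℝ f s := by
  intro hR1 f lo hi _hlt hcont hP
  obtain ⟨P, hP0, hPf⟩ := hP
  -- analyticity on a right neighbourhood of every `p ∈ [lo, hi)`
  have hright : ∀ p, lo ≤ p → p < hi → ∃ ρ > 0, ∀ s ∈ Set.Ioo p (p + ρ), AnalyticAt ℝ f s := by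
    intro p hlop hphi
    have hsub : ∀ s ∈ Set.Ioo p (p + (hi - p)), s ∈ Set.Ioo lo hi := fun s hs =>
      ⟨lt_of_le_of_lt hlop hs.1, by linarith [hs.2]⟩
    obtain ⟨e, r, he, hr, -, hnf⟩ := hR1 f p (hi - p) (sub_pos.2 hphi)
      (hcont.mono hsub) ⟨P, hP0, fun s hs => hPf s (hsub s hs)⟩
    exact ⟨r ^ e, pow_pos hr e, aoff_analyticAt_of_normalForm he hr hnf⟩
  -- analyticity on a left neighbourhood of every `p ∈ (lo, hi]`, by reflection
  have hleft : ∀ p, lo < p → p ≤ hi → ∃ ρ > 0, ∀ s ∈ Set.Ioo (p - ρ) p, AnalyticAt ℝ f s := by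
    intro p hlop hphi
    have hsub : Set.MapsTo (fun s : ℝ => -s) (Set.Ioo (-p) (-p + (p - lo))) (Set.Ioo lo hi) :=
      fun s hs => ⟨by linarith [hs.2], by linarith [hs.1]⟩
    have hgc : ContinuousOn (fun s : ℝ => f (-s)) (Set.Ioo (-p) (-p + (p - lo))) :=
      hcont.comp continuousOn_neg hsub
    obtain ⟨Q, hQ0, hQ⟩ := aoff_reflect_relation hP0
    have hgP : ∃ Q : MvPolynomial (Fin 2) ℝ, Q ≠ 0 ∧ ∀ s ∈ Set.Ioo (-p) (-p + (p - lo)),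
        MvPolynomial.eval ![s, (fun s : ℝ => f (-s)) s] Q = 0 :=
      ⟨Q, hQ0, fun s hs => by rw [hQ]; exact hPf (-s) (hsub hs)⟩
    obtain ⟨e, r, he, hr, -, hnf⟩ := hR1 (fun s : ℝ => f (-s)) (-p) (p - lo) (sub_pos.2 hlop) hgc hgP
    have hga : ∀ s ∈ Set.Ioo (-p) (-p + r ^ e), AnalyticAt ℝ (fun s : ℝ => f (-s)) s :=
      aoff_analyticAt_of_normalForm (f := fun s : ℝ => f (-s)) (p := -p) he hr hnf
    refine ⟨r ^ e, pow_pos hr e, fun s hs => ?_⟩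
    have h1 : AnalyticAt ℝ (fun s : ℝ => f (-s)) (-s) :=
      hga (-s) ⟨by linarith [hs.2], by linarith [hs.1]⟩
    have h2 : AnalyticAt ℝ ((fun s : ℝ => f (-s)) ∘ fun s : ℝ => -s) s :=
      h1.comp (analyticAt_id.fun_neg)
    have h3 : ((fun s : ℝ => f (-s)) ∘ fun s : ℝ => -s) = f := by
      funext x
      simp
    rwa [h3] at h2
  -- a punctured neighbourhood of analyticity around every point of `[lo, hi]`
  have hnbhd : ∀ p ∈ Set.Icc lo hi, ∃ U ∈ 𝓝 p, ∀ s ∈ U, s ∈ Set.Ioo lo hi → s ≠ p →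
      AnalyticAt ℝ f s := by
    intro p hp
    obtain ⟨ρ₁, hρ₁, h₁⟩ : ∃ ρ > 0, ∀ s ∈ Set.Ioo p (p + ρ), s ∈ Set.Ioo lo hi →
        AnalyticAt ℝ f s := by
      rcases lt_or_ge p hi with hphi | hphi
      · obtain ⟨ρ, hρ, h⟩ := hright p hp.1 hphi
        exact ⟨ρ, hρ, fun s hs _ => h s hs⟩
      · exact ⟨1, one_pos, fun s hs hs' => absurd hs'.2 (not_lt.2 (hphi.trans hs.1.le))⟩
    obtain ⟨ρ₂, hρ₂, h₂⟩ : ∃ ρ > 0, ∀ s ∈ Set.Ioo (p - ρ) p, s ∈ Set.Ioo lo hi →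
        AnalyticAt ℝ f s := by
      rcases lt_or_ge lo p with hlop | hlop
      · obtain ⟨ρ, hρ, h⟩ := hleft p hlop hp.2
        exact ⟨ρ, hρ, fun s hs _ => h s hs⟩
      · exact ⟨1, one_pos, fun s hs hs' => absurd hs'.1 (not_lt.2 (hs.2.le.trans hlop))⟩
    refine ⟨Set.Ioo (p - ρ₂) (p + ρ₁), isOpen_Ioo.mem_nhds ⟨by linarith, by linarith⟩, ?_⟩
    intro s hs hsI hsp
    rcases lt_or_gt_of_ne hsp with h | h
    · exact h₂ s ⟨hs.1, h⟩ hsI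
    · exact h₁ s ⟨h, hs.2⟩ hsI
  choose! U hU hUf using hnbhd
  obtain ⟨t, ht, hcov⟩ := isCompact_Icc.elim_nhds_subcover U hU
  refine ⟨t, fun s hs hst => ?_⟩
  obtain ⟨x, hxt, hsx⟩ := Set.mem_iUnion₂.1 (hcov (Set.Ioo_subset_Icc_self hs))
  exact hUf x (ht x hxt) s hsx hs fun hsx' => hst (hsx' ▸ hxt)

end Summit.KontsevichZagierPeriods.FurushoPentagon.SectorToKernel
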